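import Literature.Topology.FourManifolds.SurfaceGroupNielsenDegree
import Literature.Topology.FourManifolds.SurfaceGroupAbelianisationKernels
import Literature.GroupTheory.CombinatorialGroupTheory.HopfLiftLemmas
import Literature.GroupTheory.CombinatorialGroupTheory.TransferConjugates
import Mathlib.GroupTheory.FreeGroup.NielsenSchreier
import HarnessLib

/-!
# Finite-index subgroups of surface groups, I: lifts of an isomorphism `K ≅ S_h` to the free
# groups, and the transfer of the relator

Topic `Literature/Topology/FourManifolds`; theorems only.  Let `S_g = F/R`, `F = F⟨a, b⟩` the free
group on `surfaceGen g`, `R = ⟪r_g⟫ = ker (proj g)`, let `K ≤ S_g` have finite index `n`, put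
`E = proj⁻¹ K ≤ F` (index `n`) with `π_E : E ↠ K`, `N = ker π_E = R` (inside `E`), and let
`e : K ≃* S_h`.  This file sets up the algebraic covering-space bookkeeping used to compute the
DEGREE of the "covering" `K ≤ S_g` (`SurfaceGroupCoveringDegree.lean`):

* `exists_lift_to_preimage` / `exists_lift_from_preimage` — lifts `θ : F_h → E` of `e⁻¹` and
  `θ' : E → F_h` of `e` (free groups lift along surjections; `E` is free by Nielsen–Schreier);
* `lift_comp_lift_surfaceRelator` — Hopf: `θ'(θ(r_h)) ≡ r_h` modulo `[F_h, R_h]`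
  (`HopfLiftLemmas`), and `θ'` carries `[E, N]` into `[F_h, R_h]`, `N` into `R_h`;
* `relator_smul_coset`, `conj_relator_mem_comap` — `r_g` fixes every coset of `E`, its conjugates
  lie in `E`;
* `prod_conj_relator_mem_commutator` — TRANSFER: for a transversal `u` of `F/E` and a complete list
  `l` of the cosets without repetition, `ρ = ∏_{q ∈ l} u_q⁻¹ r_g u_q` lies in `[E, E]`
  (`TransferConjugates`), i.e. the class `res [S_g]`-dual statement `V(r_g) = 0`;
* `mk_mem_span_of_mem_ker` — GENERATION: modulo `C = [E, N]` every element of `N` is a `ℤ`-combination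
  of the classes of the `u_q⁻¹ r_g u_q` (Reidemeister–Schreier: `N` is the normal closure in `E` of
  these conjugates, and `N/C` is central in `E/C`), phrased in the `ℤ`-module
  `Additive (center (E ⧸ C))`.

References: K. S. Brown, *Cohomology of Groups*, II §5 (Hopf), III §9 (transfer); Zieschang–Vogt–
Coldewey, LNM 835, 5.5.1–5.5.3 (degree via the relation module).  No definitions; nothing here is
specific to the disputed parts of any series.
-/

noncomputable section

namespace Literature.Topology.FourManifolds

namespace SurfaceGroup

open Literature.GroupTheory.CombinatorialGroupTheory Subgroup
open scoped commutatorElement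

variable {g h : ℕ}

/-! ### The relation subgroup -/

/-- The relator is a product of commutators, hence lies in `[F, F]`. [cite: LyndonSchupp2001, Ch. II Prop. 4.1] -/
theorem surfaceRelator_mem_commutator (g : ℕ) :
    surfaceRelator g ∈ commutator (FreeGroup (surfaceGen g)) := by
  unfold surfaceRelator
  apply Subgroup.list_prod_mem
  intro x hx
  rw [List.mem_map] at hx
  obtain ⟨i, -, rfl⟩ := hx
  rw [commutator_def, ← commutatorElement_def]
  exact commutator_mem_commutator (mem_top _) (mem_top _)

/-- `ker (proj g) = ⟪r_g⟫`. [cite: LyndonSchupp2001, Ch. II Prop. 4.1] -/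
theorem ker_proj_eq_normalClosure (g : ℕ) :
    (proj g).ker = normalClosure ({surfaceRelator g} : Set (FreeGroup (surfaceGen g))) :=
  Subgroup.ext fun x => mem_ker_proj_iff x

/-- The relation subgroup lies in the commutator subgroup. [cite: LyndonSchupp2001, Ch. II Prop. 4.1] -/
theorem ker_proj_le_commutator (g : ℕ) : (proj g).ker ≤ commutator (FreeGroup (surfaceGen g)) := by
  rw [ker_proj_eq_normalClosure]
  exact normalClosure_le_normal (Set.singleton_subset_iff.mpr (surfaceRelator_mem_commutator g))

/-- The relation subgroup lies in the preimage of every subgroup of `S_g`. [cite: LyndonSchupp2001, Ch. II Prop. 4.1] -/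
theorem ker_proj_le_comap (K : Subgroup (SurfaceGroup g)) : (proj g).ker ≤ K.comap (proj g) :=
  fun x hx => by
    rw [MonoidHom.mem_ker] at hx
    rw [mem_comap, hx]
    exact one_mem K

/-- The preimage `E = proj⁻¹ K` has the index of `K`. [cite: LyndonSchupp2001, Ch. II Prop. 4.1] -/
theorem index_comap_proj (K : Subgroup (SurfaceGroup g)) : (K.comap (proj g)).index = K.index :=
  K.index_comap_of_surjective (QuotientGroup.mk'_surjective _)

/-- A conjugate `u⁻¹ r_g u` of the relator lies in `E = proj⁻¹ K`. [cite: LyndonSchupp2001, Ch. II Prop. 4.1] -/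
theorem conj_relator_mem_comap (K : Subgroup (SurfaceGroup g)) (u : FreeGroup (surfaceGen g)) :
    u⁻¹ * surfaceRelator g * u ∈ K.comap (proj g) := by
  refine ker_proj_le_comap K ?_
  have h := (MonoidHom.normal_ker (proj g)).conj_mem _ surfaceRelator_mem_ker_proj u⁻¹
  rwa [inv_inv] at h

/-- A conjugate `u⁻¹ r_g u` lies in the relation subgroup. [cite: LyndonSchupp2001, Ch. II Prop. 4.1] -/
theorem conj_relator_mem_ker (u : FreeGroup (surfaceGen g)) :
    u⁻¹ * surfaceRelator g * u ∈ (proj g).ker := by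
  have h := (MonoidHom.normal_ker (proj g)).conj_mem _ surfaceRelator_mem_ker_proj u⁻¹
  rwa [inv_inv] at h

/-- The relator fixes every coset of `E` (it lies in the normal subgroup `R ≤ E`). [cite: LyndonSchupp2001, Ch. II Prop. 4.1] -/
theorem relator_smul_coset (K : Subgroup (SurfaceGroup g))
    (q : FreeGroup (surfaceGen g) ⧸ K.comap (proj g)) : surfaceRelator g • q = q := by
  induction q using QuotientGroup.induction_on with
  | H x =>
    rw [MulAction.Quotient.smul_coe, QuotientGroup.eq, smul_eq_mul]
    have h : (surfaceRelator g * x)⁻¹ * x = x⁻¹ * (surfaceRelator g)⁻¹ * x := by group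
    rw [h]
    refine ker_proj_le_comap K ?_
    have h2 := (MonoidHom.normal_ker (proj g)).conj_mem _
      ((proj g).ker.inv_mem surfaceRelator_mem_ker_proj) x⁻¹
    rwa [inv_inv] at h2

/-- The kernel of `π_E : E ↠ K` is the relation subgroup (viewed in `E`). [cite: LyndonSchupp2001, Ch. II Prop. 4.1] -/
theorem ker_subgroupComap_eq (K : Subgroup (SurfaceGroup g)) :
    ((proj g).subgroupComap K).ker = ((proj g).ker).subgroupOf (K.comap (proj g)) := by
  ext x
  rw [MonoidHom.mem_ker, mem_subgroupOf, MonoidHom.mem_ker]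
  constructor
  · intro hx; exact congrArg Subtype.val hx
  · intro hx; exact Subtype.ext hx

/-! ### Lifts of an isomorphism `K ≅ S_h` to the free groups -/

/-- **Lift of `e⁻¹`.**  There is `θ : F_h → E` with `π_E ∘ θ = e⁻¹ ∘ proj_h` (free groups lift along
the surjection `π_E`). [cite: Brown1982CohomologyGroups, II §5 Thm 5.3] -/
theorem exists_lift_to_preimage (K : Subgroup (SurfaceGroup g)) (e : K ≃* SurfaceGroup h) :
    ∃ θ : FreeGroup (surfaceGen h) →* K.comap (proj g),
      ∀ x, (proj g).subgroupComap K (θ x) = e.symm (proj h x) := by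
  have hsurj : Function.Surjective ((proj g).subgroupComap K) :=
    MonoidHom.subgroupComap_surjective_of_surjective _ _ (QuotientGroup.mk'_surjective _)
  let s : K → K.comap (proj g) := Function.surjInv hsurj
  refine ⟨FreeGroup.lift fun i => s (e.symm (PresentedGroup.of i)), ?_⟩
  have key : ((proj g).subgroupComap K).comp (FreeGroup.lift fun i => s (e.symm (PresentedGroup.of i))) =
      e.symm.toMonoidHom.comp (proj h) := by
    refine FreeGroup.ext_hom _ _ fun i => ?_
    simp only [MonoidHom.coe_comp, Function.comp_apply, FreeGroup.lift_apply_of,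
      MulEquiv.coe_toMonoidHom]
    rw [Function.surjInv_eq hsurj]
    rfl
  intro x
  exact DFunLike.congr_fun key x

/-- **Lift of `e`.**  There is `θ' : E → F_h` with `proj_h ∘ θ' = e ∘ π_E` (`E` is free by
Nielsen–Schreier, and `proj_h` is onto). [cite: Brown1982CohomologyGroups, II §5 Thm 5.3] -/
theorem exists_lift_from_preimage (K : Subgroup (SurfaceGroup g)) (e : K ≃* SurfaceGroup h) :
    ∃ θ' : K.comap (proj g) →* FreeGroup (surfaceGen h),
      ∀ y, proj h (θ' y) = e ((proj g).subgroupComap K y) := by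
  let X : IsFreeGroup.Generators (K.comap (proj g)) → FreeGroup (surfaceGen h) := fun γ =>
    Classical.choose (QuotientGroup.mk'_surjective _ (e ((proj g).subgroupComap K (IsFreeGroup.of γ))))
  have hX : ∀ γ, proj h (X γ) = e ((proj g).subgroupComap K (IsFreeGroup.of γ)) := fun γ =>
    Classical.choose_spec
      (QuotientGroup.mk'_surjective _ (e ((proj g).subgroupComap K (IsFreeGroup.of γ))))
  refine ⟨IsFreeGroup.lift X, ?_⟩
  have key : (proj h).comp (IsFreeGroup.lift X) =
      (e.toMonoidHom.comp ((proj g).subgroupComap K)) := by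
    refine IsFreeGroup.ext_hom fun γ => ?_
    simp only [MonoidHom.coe_comp, Function.comp_apply, IsFreeGroup.lift_of, MulEquiv.coe_toMonoidHom]
    exact hX γ
  intro y
  exact DFunLike.congr_fun key y

/-! ### Hopf: the composite lift fixes the class of the relator -/

section Lifts

variable (K : Subgroup (SurfaceGroup g)) (e : K ≃* SurfaceGroup h)
  (θ : FreeGroup (surfaceGen h) →* K.comap (proj g))
  (hθ : ∀ x, (proj g).subgroupComap K (θ x) = e.symm (proj h x))
  (θ' : K.comap (proj g) →* FreeGroup (surfaceGen h))
  (hθ' : ∀ y, proj h (θ' y) = e ((proj g).subgroupComap K y))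

include hθ hθ' in
/-- `θ' ∘ θ` lifts the identity of `S_h`. [cite: Brown1982CohomologyGroups, II §5 Thm 5.3] -/
theorem proj_lift_comp_lift (x : FreeGroup (surfaceGen h)) : proj h (θ' (θ x)) = proj h x := by
  rw [hθ', hθ, MulEquiv.apply_symm_apply]

include hθ hθ' in
/-- **Hopf for the composite lift**: `θ'(θ(r_h)) ≡ r_h` modulo `[F_h, R_h]`.
[cite: Brown1982CohomologyGroups, II §5 Thm 5.3] -/
theorem lift_comp_lift_surfaceRelator :
    (θ' (θ (surfaceRelator h)))⁻¹ * surfaceRelator h ∈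
      ⁅(⊤ : Subgroup (FreeGroup (surfaceGen h))), (proj h).ker⁆ := by
  have hmod : ∀ x, ((θ'.comp θ) x)⁻¹ * (MonoidHom.id _) x ∈ (proj h).ker := by
    intro x
    rw [MonoidHom.mem_ker, map_mul, map_inv, MonoidHom.comp_apply,
      proj_lift_comp_lift K e θ hθ θ' hθ', MonoidHom.id_apply, inv_mul_cancel]
  exact QuotientGroup.mk_eq_mk_of_lifts (proj h).ker (θ'.comp θ) (MonoidHom.id _) hmod
    (surfaceRelator_mem_commutator h)

include hθ' in
/-- `θ'` carries `N = ker π_E` into `R_h`. [cite: Brown1982CohomologyGroups, II §5 Thm 5.3] -/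
theorem map_lift_ker_le :
    (((proj g).subgroupComap K).ker).map θ' ≤ (proj h).ker := by
  rintro _ ⟨y, hy, rfl⟩
  simp only [SetLike.mem_coe, MonoidHom.mem_ker] at hy
  rw [MonoidHom.mem_ker, hθ', hy, map_one]

include hθ' in
/-- `θ'` carries `[E, N]` into `[F_h, R_h]`. [cite: Brown1982CohomologyGroups, II §5 Thm 5.3] -/
theorem map_lift_commutator_le :
    (⁅(⊤ : Subgroup (K.comap (proj g))), ((proj g).subgroupComap K).ker⁆).map θ' ≤
      ⁅(⊤ : Subgroup (FreeGroup (surfaceGen h))), (proj h).ker⁆ :=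
  Subgroup.map_commutator_top_le θ' (map_lift_ker_le K e θ' hθ')

include hθ in
/-- `θ` carries `R_h` into `N = ker π_E`. [cite: Brown1982CohomologyGroups, II §5 Thm 5.3] -/
theorem map_lift_ker_le' : ((proj h).ker).map θ ≤ ((proj g).subgroupComap K).ker := by
  rintro _ ⟨x, hx, rfl⟩
  simp only [SetLike.mem_coe, MonoidHom.mem_ker] at hx
  rw [MonoidHom.mem_ker, hθ, hx, map_one]

include hθ in
/-- `θ(r_h)` lies in `N`. [cite: Brown1982CohomologyGroups, II §5 Thm 5.3] -/
theorem lift_surfaceRelator_mem_ker : θ (surfaceRelator h) ∈ ((proj g).subgroupComap K).ker :=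
  map_lift_ker_le' K e θ hθ ⟨_, surfaceRelator_mem_ker_proj, rfl⟩

/-- `θ(r_h)` lies in `[E, E]`. [cite: Brown1982CohomologyGroups, II §5 Thm 5.3] -/
theorem lift_surfaceRelator_mem_commutator : θ (surfaceRelator h) ∈ commutator (K.comap (proj g)) := by
  have h1 := surfaceRelator_mem_commutator h
  rw [commutator_def] at h1 ⊢
  have h2 : Subgroup.map θ ⁅(⊤ : Subgroup (FreeGroup (surfaceGen h))), (⊤ : Subgroup _)⁆ ≤
      ⁅(⊤ : Subgroup (K.comap (proj g))), (⊤ : Subgroup _)⁆ := by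
    rw [Subgroup.map_commutator]
    exact Subgroup.commutator_mono le_top le_top
  exact h2 ⟨_, h1, rfl⟩

end Lifts

/-! ### Transfer: the product of the conjugates of the relator over a transversal -/

/-- **Transfer of the relator.**  For a transversal `u` of `F/E` (`u_q ∈ q`) and a complete list `l`
of the cosets without repetition, the product `ρ = ∏_{q ∈ l} u_q⁻¹ r_g u_q`, an element of `E`, lies
in `[E, E]`: its image in `E^{ab}` is the transfer of `r_g ∈ [F, F]`.
[cite: Brown1982CohomologyGroups, III §9] -/
theorem prod_conj_relator_mem_commutator (K : Subgroup (SurfaceGroup g)) [K.FiniteIndex]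
    (u : FreeGroup (surfaceGen g) ⧸ K.comap (proj g) → FreeGroup (surfaceGen g))
    (hu : ∀ q, (u q : FreeGroup (surfaceGen g) ⧸ K.comap (proj g)) = q)
    (l : List (FreeGroup (surfaceGen g) ⧸ K.comap (proj g))) (hl : ∀ q, q ∈ l) (hnd : l.Nodup) :
    (l.map fun q => (⟨(u q)⁻¹ * surfaceRelator g * u q, conj_relator_mem_comap K (u q)⟩ :
        K.comap (proj g))).prod ∈ commutator (K.comap (proj g)) := by
  classical
  haveI : (K.comap (proj g)).FiniteIndex := ⟨by rw [index_comap_proj]; exact FiniteIndex.index_ne_zero⟩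
  letI := (K.comap (proj g)).fintypeQuotientOfFiniteIndex
  -- the left transversal `range u`
  let S : (K.comap (proj g)).LeftTransversal := ⟨Set.range u, isComplement_range_left hu⟩
  have hS : ∀ q, (S.2.leftQuotientEquiv q : FreeGroup (surfaceGen g)) = u q := fun q =>
    IsComplement.leftQuotientEquiv_apply hu q
  have hmem := prod_conj_mem_commutator S (relator_smul_coset K) (surfaceRelator_mem_commutator g)
  -- compare the two products in `E^{ab}` (the lists are permutations of each other)
  rw [← Abelianization.ker_of, MonoidHom.mem_ker, map_list_prod, List.map_map] at hmem ⊢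
  have hperm : l.Perm (Finset.univ : Finset (FreeGroup (surfaceGen g) ⧸ K.comap (proj g))).toList :=
    List.perm_of_nodup_nodup_toFinset_eq hnd (Finset.nodup_toList _)
      (by rw [Finset.toList_toFinset]; exact Finset.eq_univ_iff_forall.mpr fun q => by simp [hl q])
  have hfun : (Abelianization.of ∘ fun q => (⟨(u q)⁻¹ * surfaceRelator g * u q,
        conj_relator_mem_comap K (u q)⟩ : K.comap (proj g))) =
      (Abelianization.of ∘ fun q => (⟨(S.2.leftQuotientEquiv q : FreeGroup (surfaceGen g))⁻¹ *
        surfaceRelator g * S.2.leftQuotientEquiv q,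
        inv_mul_mul_mem_of_forall_smul_eq (relator_smul_coset K) _⟩ : K.comap (proj g))) := by
    funext q
    simp only [Function.comp_apply]
    congr 1
    apply Subtype.ext
    simp only [hS]
  rw [hfun, (hperm.map _).prod_eq]
  exact hmem

end SurfaceGroup

end Literature.Topology.FourManifolds
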